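import Literature.MathematicalPhysics.QuantumFieldTheory.Balaban1983to89.B1Eq324BenfattoClassSectEMemberPrecisionDoorGamma0AtOneStar
import Literature.MathematicalPhysics.QuantumFieldTheory.Balaban1983to89.Node00.OpsYSectEElimStar

/-!
# [Balaban1985UV3] (24) p. 262 ∕ [Balaban1982Higgs1] (3.24) — THE `γ₀` ROW (R5′) OF THE (3.24) PRECISION DOOR AT NODE 00's STAR SECT. E LETTERS, `U = 1`,
# PROVED FOR EVERY MEMBER: reality ∕ adjointness of the star `C(1) ∕ C(1)*`, the transfer «(2.153) on print's star subspace ⇒ `γ₀` for `η^{d+1}C*Δ_kC(1)`»,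
# and the (2.153) row DISCHARGED (dag-n08-b `scalarRow_star`, dag-n08-d `…_of_scalarRow_star_st`, def-Y STAR EDITION parts 1–3)

T. Bałaban, *Propagators for lattice gauge theories in a background field*, Commun. Math. Phys. **99** (1985) 389–434 [Balaban1985BackgroundPropagators], Sect. E
(3.156)–(3.158) p. 428; *Propagators … II*, CMP **96** (1984) 223–250 [Balaban1984PropagatorsII], (2.153)–(2.156) pp. 249–250, Lemma 2.4 p. 245, (2.3) p. 224;
*Ultraviolet stability of three-dimensional lattice pure gauge field theories*, CMP **102** (1985) 255–275 [Balaban1985UV3], (24) p. 262.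

Print, [B9] p. 428: *«exp of this quadratic form can be integrated with respect to dB̃ if C\*Δ_kC is a positive operator. Indeed it is a positive definite
operator C\*Δ_kC with a lower bound γ₀ > 0 independent of k and U. We have proved it in [4], Lemma 2.4, for operators with U = 1.»*  [4] (2.153) p. 249:
*«Δ_k ≥ (γ₀∕12d²)L^{−d−1} on the subspace of B satisfying: QB = 0, B(Γ_{y,x}) = 0 for x ∈ B(y)»* — with Λ «also a set of bonds b such that at least one of
the end-points b₋, b₊ belongs to Λ» (Lemma 2.4 p. 245): the STAR convention.

WHY THIS FILE (seat dag-n08-b g37; INTENT-20).  The lineage's (3.24) precision doors (p669260 → p680757 → p683587) are keyed to def-Y's SOURCE-convention Sect. E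
letters (`secΛY`, `lamTY`, constraints at BOTH-good corners `CBondY`), where the `γ₀` row (R5′) at `U = 1` is unsatisfiable at slab members (CHECK-L: coarse pure
gauges in the kernel).  Print's subspace is the STAR one; def-Y's STAR EDITION (part 1 p689888 `OpsYSectEStarGeometry`; parts 2–3 `OpsYSectEStar` ∕
`OpsYSectEElimStar`, typed by this seat under def-Y's conditional handover) provides the star letters `C_st ∕ C_st* ∕ Λ̃_st` and the star record
`sectEStYOfRecordV7`.  THIS FILE proves, at those letters and `U = 1`, the analytic row print cites from [4]:
* §1 REALITY ∕ ADJOINTNESS of the star `C(V) ∕ C(V)*` (ports of p671624 §2–§3 BY NAME over its generic star-chain lemmas): `star_KstY`, ★ `elimCstY_isRealOpY`,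
  `star_KTstY`, ★ `elimCtstY_isRealOpY` (star-unitary `V`), `…_of_unitary`, ★ `isAdjTr_elimCstY_elimCtstY`, ★★ `sum_trReForm_elimCΛstY_ofRecordTC` ((R3′) at the
  star record: `Σ Re tr(Ψᴴ·(P_Λ^st C P_Λ̃ Φ)) = Σ Re tr((P_Λ̃ C* P_Λ^st Ψ)ᴴ·Φ)`), `…_one` (hypothesis-free), `…_sectEStYOfRecordV7(_one)`.
* §2 THE TRANSFER (port of p683587 §1 at the star letters): ★★ `coercive_CsDeltaCPstY_one_of_ineq2153` — IF `η^{d+1}Δ_k(1)` has a lower bound `γ` on print's STAR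
  subspace «`B = 0` off `inΛstY`, `B = 0` on the axial trees, `(Q(1)B)(c) = 0` at every STAR corner `c : CBondStY x`», THEN `γ‖Φ‖² ≤ ⟨Φ, η^{d+1}C_st*Δ_kC_st(1)Φ⟩`
  for every `Λ̃_st`-supported `Φ` (`B := C_st(1)Φ` lies in the subspace by part 3's `elimCstY_one_mem_starSubspace`, `C_st` is the identity on `Λ̃_st`, and
  `C_st(1)*` is the `trReForm`-adjoint of `C_st(1)` by §1); `_frame`; ★ `coercive_CsDeltaCPstY_of_ineq2153_of_units` (general `U`, modulo unitary `V` + star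
  pivot units — print's «localizing … methods of Sect. B» row stays displayed there).
* §3 ★★★ THE ROW DISCHARGED: `coercive_CsDeltaCPstY_sectEStYOfRecordV7_one` — at the v4 letters of record `lettersYOfRecordV4 N θ M⋆ 𝔯 x` (any residual family)
  and the v7 STAR Sect. E letters `sectEStYOfRecordV7 N θ M⋆ 𝔢₀ x` (any parameters `𝔢₀`), `2 ≤ d + 1`, FOR EVERY MEMBER `x` and every `Λ̃_st`-supported `Φ`:
  **`γ₀·trIP 1 Φ Φ ≤ trIP 1 Φ (CsDeltaCPstY x (lettersYOfRecordV4 …) (sectEStYOfRecordV7 …) 1 Φ)`, `γ₀ = (1∕(12(d+1)²))·L^{−(d+2)}` member-uniform** — the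
  (2.153) row being dag-n08-d's `ineq2153_one_lettersYOfRecordV4_of_scalarRow_star_st` over dag-n08-b's `scalarRow_star` ([4] (2.118)-lower + Lemma 2.4 on
  `T^{(k)}`, p685889 ∕ p686176 ∕ p686643) with part 3's three binder facts; `_frame` (the door's `Set.range ι` shape).  This is the `γ₀` row (R5′) of the
  (3.24) precision door AT THE STAR LETTERS, `U = 1`, with NO analytic hypothesis left — print's *«We have proved it in [4], Lemma 2.4, for operators with
  U = 1»* as a kernel theorem at NODE 00.

HONEST SCOPE.  Count-neutral Literature theorems.  `U = 1` only for §3 (general `U` = p. 428's «methods of Sect. B», node N06's G-B9-09, displayed in §2's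
`_of_units`); the (3.24) door ITSELF at the star letters (Benfatto's lemma for `𝒩(0, 𝕄_ι(η^{d+1}C_st*Δ_kC_st)⁻¹)`) is NOT assembled here — it needs the star
twins of p676397 §1–§2 (`C*Δ_kC = C*(P_Λ^st Δ_k P_Λ^st)C`), of the locality ∕ column-mass rows of `C_st` (`…ERowsAtNode00`) and the P-row on `inΛstY` pairs
(successor, (t2′)); the IDENT for row `h324c` is NOT made; node N06 ∕ N08 NOT discharged; nothing of [Balaban1985UV3] ∕ [Balaban1985BackgroundPropagators] ∕
[Balaban1984PropagatorsII] asserted beyond what the tree proves; nothing about `d = 4` specifically, the continuum, OS axioms, a mass gap or Clay.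
-/

noncomputable section

open Finset Matrix
open scoped Matrix.Norms.L2Operator

namespace Literature.MathematicalPhysics.QuantumFieldTheory.Balaban1983to89.B1Eq324BenfattoClassSectEMemberPrecisionDoorAtOneStar

open Literature.MathematicalPhysics.QuantumFieldTheory
open Literature.MathematicalPhysics.QuantumFieldTheory.Balaban1983to89.Node00
open Literature.MathematicalPhysics.QuantumFieldTheory.Balaban1983to89.B1Eq324BenfattoClassSectEMemberRealAdjointAtNode00
  (star_ringInverse_apply star_secY_apply secY_isRealOpY star_Q1Y star_Q1TY sum_trReForm_adjoint_of_trace_transpose_of_real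
    isAdjTr_of_trace_transpose_of_real)
open B9PinMembersKLevelV1 (MemberY)
open B9Thm311ReadingCoords (trIP IsAdjTr)
open B9CoReadingCoordsTranspose (trReForm trReForm_symm sum_trReForm_eq_trIP)
open B7Prop2Explicit (unitaryUnits)

variable {d ℓ : ℕ} {hd : 1 ≤ d + 1} {hL : Odd (ℓ + 1) ∧ 1 < ℓ + 1} {b₀ b₁ : ℝ} {Mstar : ℕ}

/-! ## §1 Reality and `trReForm`-adjointness of the star letters `C(V) ∕ C(V)*` -/

section Reality

variable {𝔸 : Type} [NormedRing 𝔸] [NormedAlgebra ℂ 𝔸] [CompleteSpace 𝔸] [StarRing 𝔸] [StarModule ℂ 𝔸]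
variable (x : MemberY d ℓ hd hL b₀ b₁ Mstar) (𝔳 : AvY 𝔸 x) {U : CfgY 𝔸 x.toKIdx}
variable (h𝔳 : ∀ b : UBondY x, (((𝔳 U b)⁻¹ : 𝔸ˣ) : 𝔸) = star ((𝔳 U b : 𝔸ˣ) : 𝔸))
include h𝔳

/-- ★ **THE STAR PIVOT COEFFICIENT `K_c(V)` IS REAL** (p671624 `star_Q1Y`, corners only). [cite: Balaban1985BackgroundPropagators, p.428, p.391] -/
theorem star_KstY (c : CBondStY x) (a : 𝔸) : star (KstY x 𝔳 U c a) = KstY x 𝔳 U c (star a) := by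
  rw [KstY_apply, KstY_apply, star_Q1Y x 𝔳 h𝔳, ← Pi.single_star]

/-- ★★ **THE STAR LETTER `C(V)` OF (3.157) IS A REAL OPERATOR** at a star-unitary averaged field. [cite: Balaban1985BackgroundPropagators, (3.157) p.428, p.391] -/
theorem elimCstY_isRealOpY : IsRealOpY (elimCstY x 𝔳 U) := by
  intro B
  funext q
  rw [Pi.star_apply, elimCstY_apply, elimCstY_apply, star_sub, star_sum, star_secY_apply]
  congr 1
  refine Finset.sum_congr rfl fun c _ => ?_
  split_ifs
  · rw [star_ringInverse_apply _ (star_KstY x 𝔳 h𝔳 c), star_Q1Y x 𝔳 h𝔳, (secY_isRealOpY x (lamTstY x)).apply]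
  · rw [star_zero]

/-- ★ **`K_c(V)*` (star corner) IS REAL**. [cite: Balaban1985BackgroundPropagators, p.428, (3.9) p.392] -/
theorem star_KTstY (c : CBondStY x) (v : 𝔸) : star (KTstY x 𝔳 U c v) = KTstY x 𝔳 U c (star v) := by
  rw [KTstY_apply, KTstY_apply, ← Pi.star_apply (Q1TY x 𝔳 U c.1 v), star_Q1TY x 𝔳 h𝔳]

/-- ★★ **THE STAR LETTER `C(V)*` OF (3.157) IS A REAL OPERATOR** at a star-unitary averaged field. [cite: Balaban1985BackgroundPropagators, (3.157) p.428 («C*g»), (3.9) p.392] -/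
theorem elimCtstY_isRealOpY : IsRealOpY (elimCtstY x 𝔳 U) := by
  classical
  intro A
  funext q
  rw [Pi.star_apply, elimCtstY_eq, elimCtstY_eq, Pi.sub_apply, Pi.sub_apply, star_sub, Finset.sum_apply, Finset.sum_apply, star_sum,
    star_secY_apply]
  congr 1
  refine Finset.sum_congr rfl fun c _ => ?_
  rw [star_secY_apply, star_Q1TY x 𝔳 h𝔳, star_ringInverse_apply _ (star_KTstY x 𝔳 h𝔳 c), Pi.star_apply]

end Reality

section RecordAdjoint

variable {N : ℕ} (x : MemberY d ℓ hd hL b₀ b₁ Mstar) (𝔳 : AvY (Matrix (Fin N) (Fin N) ℂ) x) {U : CfgY (Matrix (Fin N) (Fin N) ℂ) x.toKIdx}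

/-- ★★ the star `C(V)` IS REAL at a unitary-valued averaged field. [cite: Balaban1985BackgroundPropagators, (3.157) p.428, p.390, p.391] -/
theorem elimCstY_isRealOpY_of_unitary
    (h𝔳 : ∀ b : UBondY x, ((𝔳 U b : (Matrix (Fin N) (Fin N) ℂ)ˣ) : Matrix (Fin N) (Fin N) ℂ) ∈ unitary (Matrix (Fin N) (Fin N) ℂ)) :
    IsRealOpY (elimCstY x 𝔳 U) :=
  elimCstY_isRealOpY x 𝔳 fun b => inv_eq_star_of_mem_unitary (h𝔳 b)

/-- ★★ the star `C(V)*` IS REAL at a unitary-valued averaged field. [cite: Balaban1985BackgroundPropagators, (3.157) p.428 («C*»), p.390, p.391] -/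
theorem elimCtstY_isRealOpY_of_unitary
    (h𝔳 : ∀ b : UBondY x, ((𝔳 U b : (Matrix (Fin N) (Fin N) ℂ)ˣ) : Matrix (Fin N) (Fin N) ℂ) ∈ unitary (Matrix (Fin N) (Fin N) ℂ)) :
    IsRealOpY (elimCtstY x 𝔳 U) :=
  elimCtstY_isRealOpY x 𝔳 fun b => inv_eq_star_of_mem_unitary (h𝔳 b)

/-- the star `C(V)` of the averaged field OF RECORD is real at a `G`-valued background, `G ≤ U(N)`. [cite: Balaban1985BackgroundPropagators, (3.157) p.428, (3.40) p.397] -/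
theorem elimCstY_avYOfRecord_isRealOpY {G : Subgroup (Matrix (Fin N) (Fin N) ℂ)ˣ} (hG : G ≤ unitaryUnits (Matrix (Fin N) (Fin N) ℂ))
    (hU : ∀ μ z, U μ z ∈ G) : IsRealOpY (elimCstY x (avYOfRecord x) U) :=
  elimCstY_isRealOpY_of_unitary x _ fun b => B7Prop2Explicit.mem_unitaryUnits.mp (hG (avYOfRecord_mem x hU b))

/-- the star `C(V)*` of the averaged field OF RECORD is real at a `G`-valued background, `G ≤ U(N)`. [cite: Balaban1985BackgroundPropagators, (3.157) p.428, (3.40) p.397] -/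
theorem elimCtstY_avYOfRecord_isRealOpY {G : Subgroup (Matrix (Fin N) (Fin N) ℂ)ˣ} (hG : G ≤ unitaryUnits (Matrix (Fin N) (Fin N) ℂ))
    (hU : ∀ μ z, U μ z ∈ G) : IsRealOpY (elimCtstY x (avYOfRecord x) U) :=
  elimCtstY_isRealOpY_of_unitary x _ fun b => B7Prop2Explicit.mem_unitaryUnits.mp (hG (avYOfRecord_mem x hU b))

/-- ★★ the star `C(V) ∕ C(V)*` IS AN ADJOINT PAIR FOR THE HERMITIAN TRACE PAIRING (`IsAdjTr 1 1`) at a unitary-valued averaged field whose star pivot coefficients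
and their transposes are units. [cite: Balaban1985BackgroundPropagators, (3.157) p.428 («C*»), (3.9) p.392, p.393] -/
theorem isAdjTr_elimCstY_elimCtstY
    (h𝔳 : ∀ b : UBondY x, ((𝔳 U b : (Matrix (Fin N) (Fin N) ℂ)ˣ) : Matrix (Fin N) (Fin N) ℂ) ∈ unitary (Matrix (Fin N) (Fin N) ℂ))
    (hK : ∀ c : CBondStY x, IsUnit (KstY x 𝔳 U c)) (hKT : ∀ c : CBondStY x, IsUnit (KTstY x 𝔳 U c)) :
    IsAdjTr (fun _ => (1 : ℝ)) (fun _ => (1 : ℝ)) (elimCstY x 𝔳 U) (elimCtstY x 𝔳 U) :=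
  isAdjTr_of_trace_transpose_of_real _ _
    (fun B A => sum_tr_elimCstY_mul x 𝔳 (Matrix.traceLinearMap (Fin N) ℂ ℂ) (fun a b => Matrix.trace_mul_comm a b) U hK hKT B A)
    (elimCtstY_isRealOpY_of_unitary x 𝔳 h𝔳)

/-- ★★★ **(R3′) OF THE PRECISION DOOR AT THE SEVEN-LETTER STAR RECORD**: at `𝔢 := sectELettersStYOfRecordTC x 𝔳 𝔢₀` (whose dressed `P_Λ^st C P_Λ̃ ∕
P_Λ̃ C* P_Λ^st` ARE `C_st(V) ∕ C_st(V)*`), for a unitary-valued averaged field with unit star pivot coefficients: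
`Σ_u Re tr((Ψu)ᴴ (P_Λ^st C P_Λ̃ Φ)(u)) = Σ_u Re tr(((P_Λ̃ C* P_Λ^st Ψ)(u))ᴴ Φ(u))`. [cite: Balaban1985BackgroundPropagators, (3.157) p.428 («B = CB̃ … C*g»), (3.9) p.392, p.391] -/
theorem sum_trReForm_elimCΛstY_ofRecordTC (𝔢₀ : SectELettersY (Matrix (Fin N) (Fin N) ℂ) x)
    (h𝔳 : ∀ b : UBondY x, ((𝔳 U b : (Matrix (Fin N) (Fin N) ℂ)ˣ) : Matrix (Fin N) (Fin N) ℂ) ∈ unitary (Matrix (Fin N) (Fin N) ℂ))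
    (hK : ∀ c : CBondStY x, IsUnit (KstY x 𝔳 U c)) (hKT : ∀ c : CBondStY x, IsUnit (KTstY x 𝔳 U c))
    (Φ Ψ : IBondY x.toKIdx → Matrix (Fin N) (Fin N) ℂ) :
    ∑ u, trReForm (Ψ u) (((elimCΛstY x (sectELettersStYOfRecordTC x 𝔳 𝔢₀) U).restrictScalars ℝ) Φ u) =
      ∑ u, trReForm (((elimCtΛstY x (sectELettersStYOfRecordTC x 𝔳 𝔢₀) U).restrictScalars ℝ) Ψ u) (Φ u) := by
  rw [elimCΛstY_sectELettersStYOfRecordTC, elimCtΛstY_sectELettersStYOfRecordTC]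
  exact sum_trReForm_adjoint_of_trace_transpose_of_real _ _
    (fun B A => sum_tr_elimCstY_mul x 𝔳 (Matrix.traceLinearMap (Fin N) ℂ ℂ) (fun a b => Matrix.trace_mul_comm a b) U hK hKT B A)
    (elimCtstY_isRealOpY_of_unitary x 𝔳 h𝔳) Φ Ψ

/-- ★★ **(R3′) AT THE SEVEN-LETTER STAR RECORD OF THE AVERAGED FIELD OF RECORD AT `U = 1` — HYPOTHESIS-FREE** (part 3's `isUnit_KstY_one ∕ isUnit_KTstY_one`,
def-Y's `avYOfRecord_one`). [cite: Balaban1985BackgroundPropagators, (3.157) p.428, p.395 (U = 1); Balaban1984PropagatorsII, (2.154)–(2.156) pp.249–250] -/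
theorem sum_trReForm_elimCΛstY_ofRecordTC_one (𝔢₀ : SectELettersY (Matrix (Fin N) (Fin N) ℂ) x) (Φ Ψ : IBondY x.toKIdx → Matrix (Fin N) (Fin N) ℂ) :
    ∑ u, trReForm (Ψ u) (((elimCΛstY x (sectELettersStYOfRecordTC x (avYOfRecord x) 𝔢₀)
        (fun _ _ => 1 : CfgY (Matrix (Fin N) (Fin N) ℂ) x.toKIdx)).restrictScalars ℝ) Φ u) =
      ∑ u, trReForm (((elimCtΛstY x (sectELettersStYOfRecordTC x (avYOfRecord x) 𝔢₀)
        (fun _ _ => 1 : CfgY (Matrix (Fin N) (Fin N) ℂ) x.toKIdx)).restrictScalars ℝ) Ψ u) (Φ u) :=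
  sum_trReForm_elimCΛstY_ofRecordTC x (avYOfRecord x) 𝔢₀ (fun b => by rw [avYOfRecord_one, Units.val_one]; exact Submonoid.one_mem _)
    (fun c => isUnit_KstY_one x c) (fun c => isUnit_KTstY_one x c) Φ Ψ

variable (N) (θ : Stage3Params) (Mstar' : ℕ) (𝔢₀ : SectEY N θ Mstar')

/-- ★★ **(R3′) AT THE v7 STAR INSTANCE OF RECORD** (`sectEStYOfRecordV7`): `G ≤ U(N)`, `G`-valued `U`, unit star pivot coefficients of `V = avYOfRecord x U`.
[cite: Balaban1985BackgroundPropagators, (3.157) p.428, (3.40) p.397, (3.9) p.392] -/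
theorem sum_trReForm_elimCΛstY_sectEStYOfRecordV7 (x : MemberY θ.d₆ θ.ℓ₆ θ.hd' θ.hL' θ.b₀ θ.b₁ Mstar')
    {G : Subgroup (Matrix (Fin N) (Fin N) ℂ)ˣ} (hG : G ≤ unitaryUnits (Matrix (Fin N) (Fin N) ℂ)) {U : CfgY (Matrix (Fin N) (Fin N) ℂ) x.toKIdx}
    (hU : ∀ μ z, U μ z ∈ G) (hK : ∀ c : CBondStY x, IsUnit (KstY x (avYOfRecord x) U c)) (hKT : ∀ c : CBondStY x, IsUnit (KTstY x (avYOfRecord x) U c))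
    (Φ Ψ : IBondY x.toKIdx → Matrix (Fin N) (Fin N) ℂ) :
    ∑ u, trReForm (Ψ u) (((elimCΛstY x (sectEStYOfRecordV7 N θ Mstar' 𝔢₀ x) U).restrictScalars ℝ) Φ u) =
      ∑ u, trReForm (((elimCtΛstY x (sectEStYOfRecordV7 N θ Mstar' 𝔢₀ x) U).restrictScalars ℝ) Ψ u) (Φ u) :=
  sum_trReForm_elimCΛstY_ofRecordTC x (avYOfRecord x) (𝔢₀ x) (fun b => B7Prop2Explicit.mem_unitaryUnits.mp (hG (avYOfRecord_mem x hU b))) hK hKT Φ Ψ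

/-- ★★ **(R3′) AT THE v7 STAR INSTANCE AT `U = 1` — HYPOTHESIS-FREE**. [cite: Balaban1985BackgroundPropagators, (3.157) p.428, p.395 (U = 1)] -/
theorem sum_trReForm_elimCΛstY_sectEStYOfRecordV7_one (x : MemberY θ.d₆ θ.ℓ₆ θ.hd' θ.hL' θ.b₀ θ.b₁ Mstar') (Φ Ψ : IBondY x.toKIdx → Matrix (Fin N) (Fin N) ℂ) :
    ∑ u, trReForm (Ψ u) (((elimCΛstY x (sectEStYOfRecordV7 N θ Mstar' 𝔢₀ x)
        (fun _ _ => 1 : CfgY (Matrix (Fin N) (Fin N) ℂ) x.toKIdx)).restrictScalars ℝ) Φ u) =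
      ∑ u, trReForm (((elimCtΛstY x (sectEStYOfRecordV7 N θ Mstar' 𝔢₀ x)
        (fun _ _ => 1 : CfgY (Matrix (Fin N) (Fin N) ℂ) x.toKIdx)).restrictScalars ℝ) Ψ u) (Φ u) :=
  sum_trReForm_elimCΛstY_ofRecordTC_one x (𝔢₀ x) Φ Ψ

end RecordAdjoint

/-! ## §2 The transfer at the star letters: [4] (2.153) on print's STAR subspace ⇒ the `γ` row of `η^{d+1}C_st*Δ_kC_st` on `Λ̃_st`-supported functions -/

section Transfer

variable {N : ℕ}

/-- one summand of the weight-one trace pairing of `Φ` with itself is `Σ_{a,b} ‖Φ(s)_{ab}‖²`, hence monotone under «`Φ(s) = 0` or `Φ(s) = B(s)`». [folklore] -/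
private theorem trIP_one_self_le_of_eq_or_zero {S : Type} [Fintype S] (Φ B : S → Matrix (Fin N) (Fin N) ℂ) (h : ∀ s, Φ s = 0 ∨ Φ s = B s) :
    trIP (fun _ => (1 : ℝ)) Φ Φ ≤ trIP (fun _ => (1 : ℝ)) B B := by
  unfold trIP
  refine Finset.sum_le_sum fun s _ => ?_
  rw [one_mul, one_mul]
  rcases h s with h0 | hB
  · rw [h0]
    simp only [Matrix.zero_apply, star_zero, zero_mul, Complex.zero_re, Finset.sum_const_zero]
    exact Finset.sum_nonneg fun a _ => Finset.sum_nonneg fun b _ => by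
      rw [Complex.star_def, ← Complex.normSq_eq_conj_mul_self, Complex.ofReal_re]; exact Complex.normSq_nonneg _
  · rw [hB]

variable (x : MemberY d ℓ hd hL b₀ b₁ Mstar)

/-- ★★ **THE `γ` ROW OF `η^{d+1}C_st*Δ_kC_st(1)` FROM [4] (2.153) ON PRINT's STAR SUBSPACE.**  At a member `x`, any covariance letters `𝔏`, the seven-letter STAR
Sect. E record `sectELettersStYOfRecordTC x (avYOfRecord x) 𝔢₀` (part 3: its dressed `P_Λ^st C P_Λ̃ ∕ P_Λ̃ C* P_Λ^st` ARE `C_st(V) ∕ C_st(V)*`) and `U = 1`: IF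
`η^{d+1}Δ_k(1)` (part 2's `deltaKPstY … 1` = def-Y's `deltaKPY … 1`, the SAME operator) satisfies `γ‖B‖² ≤ ⟨B, η^{d+1}Δ_k(1)B⟩` for every `B` in print's STAR
subspace — `B = 0` off the bonds with a good end block (`inΛstY`), `B = 0` on the axial trees (`IsAxialY`), `(Q₁(1)B)(c) = 0` at every STAR corner
`c : CBondStY x` (at least one good end block; [4] Lemma 2.4's «c ∈ Λ′») — THEN `γ‖Φ‖² ≤ ⟨Φ, η^{d+1}C_st*Δ_kC_st(1)Φ⟩` for every `Φ` supported in `Λ̃_st`.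
Proof = print's parametrisation `B = C_stB̃`: `⟨Φ, C_st*(η^{d+1}Δ_k)C_stΦ⟩ = ⟨C_stΦ, η^{d+1}Δ_k C_stΦ⟩` (part 2 `CsDeltaCPstY_eq`, §1's `U = 1` adjointness);
`B := C_st(1)Φ` lies in the star subspace (part 3 `elimCstY_one_mem_starSubspace`); `‖B‖² ≥ ‖Φ‖²` since `C_st` is the identity on `Λ̃_st`
(`elimCstY_one_apply_of_lamTstY`). [cite: Balaban1985BackgroundPropagators, (3.156)–(3.158) p.428; Balaban1984PropagatorsII, (2.153) p.249, (2.154)–(2.156) pp.249–250, Lemma 2.4 (2.128) p.245, (2.3) p.224] -/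
theorem coercive_CsDeltaCPstY_one_of_ineq2153 (𝔏 : CovLettersY (Matrix (Fin N) (Fin N) ℂ) x)
    (𝔢₀ : SectELettersY (Matrix (Fin N) (Fin N) ℂ) x) {γ : ℝ} (hγ : 0 ≤ γ)
    (h2153 : ∀ B : IBondY x.toKIdx → Matrix (Fin N) (Fin N) ℂ,
      (∀ q, ¬ inΛstY x q → B q = 0) → (∀ q, IsAxialY x q → B q = 0) →
      (∀ c : CBondStY x, Q1Y x (avYOfRecord x) (fun _ _ => 1 : CfgY (Matrix (Fin N) (Fin N) ℂ) x.toKIdx) c.1 B = 0) →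
        γ * trIP (fun _ => (1 : ℝ)) B B ≤
          trIP (fun _ => (1 : ℝ)) B (deltaKPstY x 𝔏 (sectELettersStYOfRecordTC x (avYOfRecord x) 𝔢₀) (fun _ _ => 1) B))
    (Φ : IBondY x.toKIdx → Matrix (Fin N) (Fin N) ℂ) (hΦ : ∀ q, ¬ lamTstY x q → Φ q = 0) :
    γ * trIP (fun _ => (1 : ℝ)) Φ Φ ≤
      trIP (fun _ => (1 : ℝ)) Φ (CsDeltaCPstY x 𝔏 (sectELettersStYOfRecordTC x (avYOfRecord x) 𝔢₀) (fun _ _ => 1) Φ) := by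
  set B : IBondY x.toKIdx → Matrix (Fin N) (Fin N) ℂ :=
    elimCstY x (avYOfRecord x) (fun _ _ => 1 : CfgY (Matrix (Fin N) (Fin N) ℂ) x.toKIdx) Φ with hB
  have hC : elimCΛstY x (sectELettersStYOfRecordTC x (avYOfRecord x) 𝔢₀)
      (fun _ _ => 1 : CfgY (Matrix (Fin N) (Fin N) ℂ) x.toKIdx) Φ = B := by
    rw [elimCΛstY_sectELettersStYOfRecordTC]
  have hform : trIP (fun _ => (1 : ℝ)) Φ
        (CsDeltaCPstY x 𝔏 (sectELettersStYOfRecordTC x (avYOfRecord x) 𝔢₀) (fun _ _ => 1) Φ) =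
      trIP (fun _ => (1 : ℝ)) B (deltaKPstY x 𝔏 (sectELettersStYOfRecordTC x (avYOfRecord x) 𝔢₀) (fun _ _ => 1) B) := by
    rw [CsDeltaCPstY_eq, Module.End.mul_apply, Module.End.mul_apply, hC, ← sum_trReForm_eq_trIP, ← sum_trReForm_eq_trIP]
    have ht := sum_trReForm_elimCΛstY_ofRecordTC_one x 𝔢₀ Φ
      (deltaKPstY x 𝔏 (sectELettersStYOfRecordTC x (avYOfRecord x) 𝔢₀) (fun _ _ => 1) B)
    simp only [LinearMap.restrictScalars_apply] at ht
    rw [hC] at ht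
    calc ∑ u, trReForm (Φ u) (elimCtΛstY x (sectELettersStYOfRecordTC x (avYOfRecord x) 𝔢₀) (fun _ _ => 1)
              (deltaKPstY x 𝔏 (sectELettersStYOfRecordTC x (avYOfRecord x) 𝔢₀) (fun _ _ => 1) B) u)
        = ∑ u, trReForm (elimCtΛstY x (sectELettersStYOfRecordTC x (avYOfRecord x) 𝔢₀) (fun _ _ => 1)
              (deltaKPstY x 𝔏 (sectELettersStYOfRecordTC x (avYOfRecord x) 𝔢₀) (fun _ _ => 1) B) u) (Φ u) :=
          Finset.sum_congr rfl fun u _ => trReForm_symm _ _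
      _ = ∑ u, trReForm (deltaKPstY x 𝔏 (sectELettersStYOfRecordTC x (avYOfRecord x) 𝔢₀) (fun _ _ => 1) B u) (B u) := ht.symm
      _ = ∑ u, trReForm (B u) (deltaKPstY x 𝔏 (sectELettersStYOfRecordTC x (avYOfRecord x) 𝔢₀) (fun _ _ => 1) B u) :=
          Finset.sum_congr rfl fun u _ => trReForm_symm _ _
  rw [hform]
  obtain ⟨hBD, hBA, hBQ⟩ := elimCstY_one_mem_starSubspace x Φ
  have hle : trIP (fun _ => (1 : ℝ)) Φ Φ ≤ trIP (fun _ => (1 : ℝ)) B B :=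
    trIP_one_self_le_of_eq_or_zero Φ B fun q => by
      by_cases hq : lamTstY x q
      · exact Or.inr (elimCstY_one_apply_of_lamTstY x Φ hq).symm
      · exact Or.inl (hΦ q hq)
  exact (mul_le_mul_of_nonneg_left hle hγ).trans (h2153 B hBD hBA hBQ)

/-- ★ **THE SAME TRANSFER FOR A `Λ̃_st`-FRAME SUPPORT** — the literal shape of the door's `γ₀` row: `Φ` vanishing off the range of a `Λ̃_st`-valued index `ι`.
[cite: Balaban1985BackgroundPropagators, (3.156)–(3.158) p.428; Balaban1984PropagatorsII, (2.153) p.249] -/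
theorem coercive_CsDeltaCPstY_one_of_ineq2153_frame (𝔏 : CovLettersY (Matrix (Fin N) (Fin N) ℂ) x)
    (𝔢₀ : SectELettersY (Matrix (Fin N) (Fin N) ℂ) x) {γ : ℝ} (hγ : 0 ≤ γ)
    (h2153 : ∀ B : IBondY x.toKIdx → Matrix (Fin N) (Fin N) ℂ,
      (∀ q, ¬ inΛstY x q → B q = 0) → (∀ q, IsAxialY x q → B q = 0) →
      (∀ c : CBondStY x, Q1Y x (avYOfRecord x) (fun _ _ => 1 : CfgY (Matrix (Fin N) (Fin N) ℂ) x.toKIdx) c.1 B = 0) →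
        γ * trIP (fun _ => (1 : ℝ)) B B ≤
          trIP (fun _ => (1 : ℝ)) B (deltaKPstY x 𝔏 (sectELettersStYOfRecordTC x (avYOfRecord x) 𝔢₀) (fun _ _ => 1) B))
    {σ : Type} (ι : σ → IBondY x.toKIdx) (hιT : ∀ s, lamTstY x (ι s))
    (Φ : IBondY x.toKIdx → Matrix (Fin N) (Fin N) ℂ) (hΦ : ∀ u, u ∉ Set.range ι → Φ u = 0) :
    γ * trIP (fun _ => (1 : ℝ)) Φ Φ ≤
      trIP (fun _ => (1 : ℝ)) Φ (CsDeltaCPstY x 𝔏 (sectELettersStYOfRecordTC x (avYOfRecord x) 𝔢₀) (fun _ _ => 1) Φ) :=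
  coercive_CsDeltaCPstY_one_of_ineq2153 x 𝔏 𝔢₀ hγ h2153 Φ fun q hq => hΦ q fun hq' => hq (by obtain ⟨s, rfl⟩ := hq'; exact hιT s)

variable (𝔳 : AvY (Matrix (Fin N) (Fin N) ℂ) x)

/-- ★★ **THE SAME TRANSFER AT A GENERAL BACKGROUND, MODULO THE STAR PIVOT UNITS** — for an averaged field `V = 𝔳 U` with unitary values whose star pivot
coefficients `K_c(V)` and their transposes are units, a lower bound `γ` for `η^{d+1}Δ_k(U)` on the `V`-constrained STAR subspace «`B = 0` off `inΛstY`, `B = 0`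
on the axial trees, `(Q(V)B)(c) = 0` at every star corner» IS a lower bound `γ` for `η^{d+1}C_st(V)*Δ_k(U)C_st(V)` on the `Λ̃_st`-supported functions.  (Print,
p. 428: *«Localizing the operators in Δ_k and using the methods of Sect. B we can prove it for C\*Δ_kC with an arbitrary configuration U …»* — node N06's
G-B9-09, NOT claimed; this theorem only moves it between the two operators.) [cite: Balaban1985BackgroundPropagators, (3.156)–(3.158) p.428, (3.9) p.392; Balaban1984PropagatorsII, (2.153)–(2.156) pp.249–250] -/
theorem coercive_CsDeltaCPstY_of_ineq2153_of_units (𝔏 : CovLettersY (Matrix (Fin N) (Fin N) ℂ) x)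
    (𝔢₀ : SectELettersY (Matrix (Fin N) (Fin N) ℂ) x) {U : CfgY (Matrix (Fin N) (Fin N) ℂ) x.toKIdx}
    (h𝔳 : ∀ b : UBondY x, ((𝔳 U b : (Matrix (Fin N) (Fin N) ℂ)ˣ) : Matrix (Fin N) (Fin N) ℂ) ∈ unitary (Matrix (Fin N) (Fin N) ℂ))
    (hK : ∀ c : CBondStY x, IsUnit (KstY x 𝔳 U c)) (hKT : ∀ c : CBondStY x, IsUnit (KTstY x 𝔳 U c)) {γ : ℝ} (hγ : 0 ≤ γ)
    (h2153 : ∀ B : IBondY x.toKIdx → Matrix (Fin N) (Fin N) ℂ,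
      (∀ q, ¬ inΛstY x q → B q = 0) → (∀ q, IsAxialY x q → B q = 0) → (∀ c : CBondStY x, Q1Y x 𝔳 U c.1 B = 0) →
        γ * trIP (fun _ => (1 : ℝ)) B B ≤ trIP (fun _ => (1 : ℝ)) B (deltaKPstY x 𝔏 (sectELettersStYOfRecordTC x 𝔳 𝔢₀) U B))
    (Φ : IBondY x.toKIdx → Matrix (Fin N) (Fin N) ℂ) (hΦ : ∀ q, ¬ lamTstY x q → Φ q = 0) :
    γ * trIP (fun _ => (1 : ℝ)) Φ Φ ≤ trIP (fun _ => (1 : ℝ)) Φ (CsDeltaCPstY x 𝔏 (sectELettersStYOfRecordTC x 𝔳 𝔢₀) U Φ) := by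
  set B : IBondY x.toKIdx → Matrix (Fin N) (Fin N) ℂ := elimCstY x 𝔳 U Φ
  have hC : elimCΛstY x (sectELettersStYOfRecordTC x 𝔳 𝔢₀) U Φ = B := by rw [elimCΛstY_sectELettersStYOfRecordTC]
  have hform : trIP (fun _ => (1 : ℝ)) Φ (CsDeltaCPstY x 𝔏 (sectELettersStYOfRecordTC x 𝔳 𝔢₀) U Φ) =
      trIP (fun _ => (1 : ℝ)) B (deltaKPstY x 𝔏 (sectELettersStYOfRecordTC x 𝔳 𝔢₀) U B) := by
    rw [CsDeltaCPstY_eq, Module.End.mul_apply, Module.End.mul_apply, hC, ← sum_trReForm_eq_trIP, ← sum_trReForm_eq_trIP]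
    have ht := sum_trReForm_elimCΛstY_ofRecordTC x 𝔳 𝔢₀ h𝔳 hK hKT Φ (deltaKPstY x 𝔏 (sectELettersStYOfRecordTC x 𝔳 𝔢₀) U B)
    simp only [LinearMap.restrictScalars_apply] at ht
    rw [hC] at ht
    calc ∑ u, trReForm (Φ u) (elimCtΛstY x (sectELettersStYOfRecordTC x 𝔳 𝔢₀) U (deltaKPstY x 𝔏 (sectELettersStYOfRecordTC x 𝔳 𝔢₀) U B) u)
        = ∑ u, trReForm (elimCtΛstY x (sectELettersStYOfRecordTC x 𝔳 𝔢₀) U (deltaKPstY x 𝔏 (sectELettersStYOfRecordTC x 𝔳 𝔢₀) U B) u) (Φ u) :=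
          Finset.sum_congr rfl fun u _ => trReForm_symm _ _
      _ = ∑ u, trReForm (deltaKPstY x 𝔏 (sectELettersStYOfRecordTC x 𝔳 𝔢₀) U B u) (B u) := ht.symm
      _ = ∑ u, trReForm (B u) (deltaKPstY x 𝔏 (sectELettersStYOfRecordTC x 𝔳 𝔢₀) U B u) :=
          Finset.sum_congr rfl fun u _ => trReForm_symm _ _
  rw [hform]
  have hBD : ∀ q, ¬ inΛstY x q → B q = 0 := fun q hq => elimCstY_apply_of_not_inΛstY x 𝔳 U Φ hq
  have hBA : ∀ q, IsAxialY x q → B q = 0 := fun q hq => elimCstY_apply_of_isAxialY x 𝔳 U Φ hq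
  have hBQ : ∀ c : CBondStY x, Q1Y x 𝔳 U c.1 B = 0 := fun c => Q1Y_elimCstY x 𝔳 U (hK c) Φ
  have hle : trIP (fun _ => (1 : ℝ)) Φ Φ ≤ trIP (fun _ => (1 : ℝ)) B B :=
    trIP_one_self_le_of_eq_or_zero Φ B fun q => by
      by_cases hq : lamTstY x q
      · exact Or.inr (elimCstY_apply_of_lamTstY x 𝔳 U Φ hq).symm
      · exact Or.inl (hΦ q hq)
  exact (mul_le_mul_of_nonneg_left hle hγ).trans (h2153 B hBD hBA hBQ)

end Transfer

/-! ## §3 ★★★ THE `γ₀` ROW OF THE STAR PRECISION AT `U = 1`, PROVED FOR EVERY MEMBER (the (2.153) row discharged) -/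

section Discharged

variable (N : ℕ) (θ : Stage3Params) (Mstar' : ℕ) (𝔯 : ResY N θ Mstar') (𝔢₀ : SectEY N θ Mstar')

open B1Eq324BenfattoClassSectEMemberIneq2153ScalarReductionAtNode00 (ineq2153_one_lettersYOfRecordV4_of_scalarRow_star_st)
open B1Eq324BenfattoClassSectEMemberPrecisionDoorGamma0AtOneStar (scalarRow_star)

/-- ★★★ **THE (2.153) ROW AT NODE 00's LETTERS OF RECORD, STAR SUBSPACE, IN part 2's CURRENCY**: for every member `x` (`2 ≤ d + 1`), every residual family `𝔯`,
every Sect. E parameter family `𝔢₀` and every `B` in print's STAR subspace (`B = 0` off `inΛstY`, on the axial trees, `(Q₁(1)B)(c) = 0` at every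
`c : CBondStY x`): `γ₀·trIP 1 B B ≤ trIP 1 B (deltaKPstY x (lettersYOfRecordV4 …) (sectEStYOfRecordV7 … 𝔢₀ x) 1 B)`, `γ₀ = (1∕(12(d+1)²))·L^{−(d+2)}` — dag-n08-d's
`ineq2153_one_lettersYOfRecordV4_of_scalarRow_star_st` over dag-n08-b's `scalarRow_star`, with `deltaKPstY … (sectEStYOfRecordV7 …) = deltaKPY … (sectEYOfRecordV6 …)`
(part 3, `rfl`). [cite: Balaban1984PropagatorsII, (2.153) p.249, (2.118) p.243, Lemma 2.4 (2.128) p.245, (2.3) p.224; Balaban1985BackgroundPropagators, (3.156) p.428, (3.132) p.422, Cor. 3.5 p.407] -/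
theorem ineq2153_one_lettersYOfRecordV4_sectEStYOfRecordV7 (hD : 2 ≤ θ.d₆ + 1) (x : MemberY θ.d₆ θ.ℓ₆ θ.hd' θ.hL' θ.b₀ θ.b₁ Mstar')
    (B : IBondY x.toKIdx → Matrix (Fin N) (Fin N) ℂ) (hΛ : ∀ q, ¬ inΛstY x q → B q = 0) (hAx : ∀ q, IsAxialY x q → B q = 0)
    (hQ : ∀ c : CBondStY x, Q1Y x (avYOfRecord x) (fun _ _ => 1 : CfgY (Matrix (Fin N) (Fin N) ℂ) x.toKIdx) c.1 B = 0) :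
    1 / (12 * (((θ.d₆ + 1 : ℕ) : ℝ)) ^ 2) * ((((θ.ℓ₆ + 1 : ℕ) : ℝ)) ^ (θ.d₆ + 2))⁻¹ * trIP (fun _ => (1 : ℝ)) B B ≤
      trIP (fun _ => (1 : ℝ)) B (deltaKPstY x (lettersYOfRecordV4 N θ Mstar' 𝔯 x) (sectEStYOfRecordV7 N θ Mstar' 𝔢₀ x) (fun _ _ => 1) B) := by
  rw [(deltaKstY_sectEStYOfRecordV7 N θ Mstar' 𝔢₀ x (lettersYOfRecordV4 N θ Mstar' 𝔯 x) (fun _ _ => 1)).2]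
  exact ineq2153_one_lettersYOfRecordV4_of_scalarRow_star_st N θ Mstar' 𝔯 x (sectEYOfRecordV6 N θ Mstar' 𝔢₀ x) (scalarRow_star x (by omega)) B hΛ hAx hQ

/-- ★★★ **THE `γ₀` ROW (R5′) OF THE (3.24) PRECISION DOOR AT THE STAR LETTERS, `U = 1`, FOR EVERY MEMBER — NO ANALYTIC HYPOTHESIS** ([B9] p. 428: *«a positive
definite operator C\*Δ_kC with a lower bound γ₀ > 0 independent of k and U. We have proved it in [4], Lemma 2.4, for operators with U = 1»*): at the v4 letters of
record `lettersYOfRecordV4 N θ M⋆ 𝔯 x` (any residual family) and the v7 STAR Sect. E letters `sectEStYOfRecordV7 N θ M⋆ 𝔢₀ x` (any parameters), `2 ≤ d + 1`, for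
every member `x` and every `Φ` supported in the star variables `Λ̃_st`:
**`γ₀·trIP 1 Φ Φ ≤ trIP 1 Φ (CsDeltaCPstY x (lettersYOfRecordV4 …) (sectEStYOfRecordV7 …) 1 Φ)`, `γ₀ = (1∕(12(d+1)²))·L^{−(d+2)}` member-uniform** (`L = ℓ+1`;
[4]'s `(γ₀∕12d²)L^{−d−1}` with Jensen's `γ₀ = 1`, `d ↦ d+1`, in def-Y's print units). [cite: Balaban1985BackgroundPropagators, (3.156)–(3.158) p.428; Balaban1984PropagatorsII, (2.153)–(2.156) pp.249–250, Lemma 2.4 (2.128) p.245, (2.118) p.243, (2.3) p.224; Balaban1985UV3, (24) p.262] -/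
theorem coercive_CsDeltaCPstY_sectEStYOfRecordV7_one (hD : 2 ≤ θ.d₆ + 1) (x : MemberY θ.d₆ θ.ℓ₆ θ.hd' θ.hL' θ.b₀ θ.b₁ Mstar')
    (Φ : IBondY x.toKIdx → Matrix (Fin N) (Fin N) ℂ) (hΦ : ∀ q, ¬ lamTstY x q → Φ q = 0) :
    1 / (12 * (((θ.d₆ + 1 : ℕ) : ℝ)) ^ 2) * ((((θ.ℓ₆ + 1 : ℕ) : ℝ)) ^ (θ.d₆ + 2))⁻¹ * trIP (fun _ => (1 : ℝ)) Φ Φ ≤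
      trIP (fun _ => (1 : ℝ)) Φ (CsDeltaCPstY x (lettersYOfRecordV4 N θ Mstar' 𝔯 x) (sectEStYOfRecordV7 N θ Mstar' 𝔢₀ x) (fun _ _ => 1) Φ) :=
  coercive_CsDeltaCPstY_one_of_ineq2153 x (lettersYOfRecordV4 N θ Mstar' 𝔯 x) (𝔢₀ x) (by positivity)
    (ineq2153_one_lettersYOfRecordV4_sectEStYOfRecordV7 N θ Mstar' 𝔯 𝔢₀ hD x) Φ hΦ

/-- ★★★ **THE SAME IN THE DOOR's FRAME SHAPE**: `Φ` vanishing off the range of a `Λ̃_st`-valued frame index `ι` (the `hco` binder of the precision doors, at the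
star letters). [cite: Balaban1985BackgroundPropagators, (3.156)–(3.158) p.428; Balaban1984PropagatorsII, (2.153) p.249; Balaban1985UV3, (24) p.262] -/
theorem coercive_CsDeltaCPstY_sectEStYOfRecordV7_one_frame (hD : 2 ≤ θ.d₆ + 1) (x : MemberY θ.d₆ θ.ℓ₆ θ.hd' θ.hL' θ.b₀ θ.b₁ Mstar')
    {σ : Type} (ι : σ → IBondY x.toKIdx) (hιT : ∀ s, lamTstY x (ι s))
    (Φ : IBondY x.toKIdx → Matrix (Fin N) (Fin N) ℂ) (hΦ : ∀ u, u ∉ Set.range ι → Φ u = 0) :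
    1 / (12 * (((θ.d₆ + 1 : ℕ) : ℝ)) ^ 2) * ((((θ.ℓ₆ + 1 : ℕ) : ℝ)) ^ (θ.d₆ + 2))⁻¹ * trIP (fun _ => (1 : ℝ)) Φ Φ ≤
      trIP (fun _ => (1 : ℝ)) Φ (CsDeltaCPstY x (lettersYOfRecordV4 N θ Mstar' 𝔯 x) (sectEStYOfRecordV7 N θ Mstar' 𝔢₀ x) (fun _ _ => 1) Φ) :=
  coercive_CsDeltaCPstY_sectEStYOfRecordV7_one N θ Mstar' 𝔯 𝔢₀ hD x Φ
    fun q hq => hΦ q fun hq' => hq (by obtain ⟨s, rfl⟩ := hq'; exact hιT s)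

/-- ★ **POSITIVITY OF THE STAR PRECISION ON `Λ̃_st`**: the real quadratic form `Φ ↦ trIP 1 Φ (η^{d+1}C_st*Δ_kC_st(1)Φ)` is positive definite on the `Λ̃_st`-supported
functions (`γ₀ > 0`) — print's «exp of this quadratic form can be integrated with respect to dB̃ if C\*Δ_kC is a positive operator» at `U = 1`, every member.
[cite: Balaban1985BackgroundPropagators, p.428; Balaban1984PropagatorsII, (2.153) p.249] -/
theorem trIP_CsDeltaCPstY_sectEStYOfRecordV7_one_pos (hD : 2 ≤ θ.d₆ + 1) (x : MemberY θ.d₆ θ.ℓ₆ θ.hd' θ.hL' θ.b₀ θ.b₁ Mstar')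
    (Φ : IBondY x.toKIdx → Matrix (Fin N) (Fin N) ℂ) (hΦ : ∀ q, ¬ lamTstY x q → Φ q = 0) (hΦ0 : 0 < trIP (fun _ => (1 : ℝ)) Φ Φ) :
    0 < trIP (fun _ => (1 : ℝ)) Φ (CsDeltaCPstY x (lettersYOfRecordV4 N θ Mstar' 𝔯 x) (sectEStYOfRecordV7 N θ Mstar' 𝔢₀ x) (fun _ _ => 1) Φ) := by
  have hγ : 0 < 1 / (12 * (((θ.d₆ + 1 : ℕ) : ℝ)) ^ 2) * ((((θ.ℓ₆ + 1 : ℕ) : ℝ)) ^ (θ.d₆ + 2))⁻¹ := by positivity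
  exact (mul_pos hγ hΦ0).trans_le (coercive_CsDeltaCPstY_sectEStYOfRecordV7_one N θ Mstar' 𝔯 𝔢₀ hD x Φ hΦ)

end Discharged

end Literature.MathematicalPhysics.QuantumFieldTheory.Balaban1983to89.B1Eq324BenfattoClassSectEMemberPrecisionDoorAtOneStar

end
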